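import Summits.QuantumFields.YangMills.Theorems.BalabanUVNodesN11SupplyChainFirstLink
import Summits.QuantumFields.YangMills.Theorems.BalabanUVNodesN11Sect3SupplyChainTermRows

/-!
# DAG node N11 — THE FIRST-STEP SUPPLIER's CHAIN (the chain with ONE live link): in a run whose expansion children ABOVE THE FIRST LEVEL carry no 𝐓-slot, the SUPPLIER SIDE of N11's token `SupplyChainAt θ p` IS
# FIRST-STEP DATA (the first-step supplier `firstStepSupplier θ p u E₁` meets `SupplierObligations`, and every supplier that does is matched by one), def-T's operand rows along its chain come
# from `u`'s term rows, and THEOREM 1 OF [III], all levels, all histories, follows from FIRST-STEP DATA + the rows — the join of this seat's one-step run (`K = 1`, p597418 §5) and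
# dag-n11-e's all-𝐓-absent run (zero supplier, p597757)

HEADER — WORK-UNIT METADATA.  Cell `pub-ymgap`, YM-PLAN Track A (HUMAN RULING D-0062 ∕ D-0149 width push), seat `pub-ymgap-dag-n08-w2` (g6; WIDTH SEAT 2∕4 on N08 [B10],
re-pointed by the dag-lead desk to N11's §3-supply residue, DEDUP-354∕355; harness re-seat of g2), route `BalabanUVNodes` rev 25 (v1.7 `CoPH` key), item K1⁷
`StabilityBAtRecordR13SepCoPH` = stmt-QuantumFields-20542; PROOF lane (`--kind proof --supports 20542 --as helper`; theorems only, 0 `def`), count-neutral.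
[III] = [Balaban1988Convergent], [I] = [Balaban1987RG1], [IV] = [Balaban1989LargeFieldI].  Over this seat's `…N11SupplyChainFirstLink` (p597418: `FirstStepClausesAt`,
`FirstLinkObligations`, `firstStepSupplier`, `presentChildObligations_zero_iff`, `firstLinkObligations_firstStepSupplier_iff`), dag-n11-e's `…Sect3SupplyChainObligationsDefs ∕
…Node ∕ …Zero` (p595576 ∕ p596032 ∕ p597757: `SupplierObligations`, `NoExpansionObligation`, `SupplyChainAt`, `OperandRowsAlongChain`, `ResidualRows`, the node ∕ record faces,
`newEClausesAt_zero`) and dag-n11-w3's `…Sect3SupplyChainTermRows` (`TermRowsAt`, `SupplierTermRows`, `operandRowsAlongChain_of_supplierTermRows`, `termRowsAt_zero`).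

WHY THIS FILE.  Two degenerate corners of N11's chain road are in the tree: for a ONE-STEP run (`K = 1`) the token IS the first step (this seat, p597418 §5), and in a run whose
expansion children are ALL 𝐓-absent the ZERO supplier meets the obligations (dag-n11-e, p597757 §2).  Their join is the run in which the 𝐓-image charges expansion children AT THE
FIRST LEVEL ONLY («absent above the first level»: `slotsT_{k+1}(s′) ≡ 0` whenever `Ω_{k+1}(s′) ≠ ∅`, for `1 ≤ k < K`; nothing is asked at `k = 0`, where the first step IS owed;
vacuous for `K ≤ 1`; implied by all-absent).  There the supplier with the first-step response at level `0` and NOTHING above — `firstStepSupplier θ p u E₁` — carries the chain: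
§1 along its own chain its (loc) field is `1`-locality of `u` and its term rows (dag-n11-w3) are `u`'s, so def-T's operand rows along its chain follow from `u`'s term rows — NO
   absence hypothesis;
§2 ★ it meets `SupplierObligations` iff `u` is `1`-local and (`0 < K`) the first link holds (`0 ≤ E₀` for the zero terms' 𝐄-bound above; at `k ≥ 1` the zero response owes nothing
   at the expansion children — all 𝐓-absent); ★ conversely ANY supplier meeting its obligations is matched by the first-step supplier of ITS OWN level-`0` response — so ★★
   `(∃ σ, SupplierObligations θ p σ)` ⟺ «first-step data» (`1`-locality, universality in 𝐄, the four level-`1` 𝐄-clauses, the first-step clauses at the 𝐓-present pairs):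
   THE SUPPLIER SIDE OF N11's TOKEN IS [I] Thm 1 + [II] AND NOTHING ELSE in such a run (the no-expansion half stays chain-keyed);
§3∕§4 its no-expansion obligation is discharged from the witness-free residual rows + `u`'s term rows (dag-n11-d's road) or at a Gaussian certificate from `u`'s term rows alone
   (dag-n11-w1's road) — NO absence hypothesis; hence `SupplyChainAt θ p` from first-step data + rows in such a run;
§5 THEOREM 1 OF [III], all levels, all histories, in such a run: generic `θ` on the live-selector line from first-step data + `ResidualRows` + `u`'s term rows; any Gaussian-class
   `θ` from first-step data + `u`'s term rows; the law form of the Theorem of p. 245 (the `h11`-consequent);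
§6 the corner `K ≤ 1` without `0 ≤ E₀` and without the absence hypothesis (every field above level `0` void); the all-absent corner is §2 ★ with (present) vacuous at `k = 0` too;
§7 at the H-extensions of the witness of record (any ∕ Gaussian-class): Theorem 1, all levels, from `hrec`, first-step data and the rows — NOTHING ELSE (dag-n11-e proved these
   from absence at EVERY level with the zero supplier; here the first level is LIVE and paid for by the first link).

HONEST FRAMING.  Count-neutral KERNEL BOOKKEEPING over landed definitions (case splits on the level, the zero rows, three compositions); the absence-above-the-first-level world is
a DEGENERATE data regime (for the record's data the 𝐓-slots at expansion children of every level are charged — that is where [III] §3 is owed); the first-step clauses at the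
𝐓-present pairs ARE [I] Thm 1 + [II] at def-T's level-1 objects — NOT proved here for any `θ`, run or history (NODE 00-sized; the (S-α) objects (D1)–(D4) are not in the tree);
nothing of Bałaban asserted; N11 NOT discharged; N08 untouched; K1⁷ NOT closed; counts unmoved (typed 28∕28 · discharged 5∕27).  One finite `𝕋⁴_{L^K}` programme at fixed
`ε = L^{−K}`; R4 closes only the conditional finite-𝕋⁴ rung `BalabanLadder.UV` — NOT ℝ⁴, NOT OS, NOT a mass gap, NOT Clay.  No `sorry`, no `axiom`, no `def`, no `instance`, no `notation`.
Sources (SHAPE only): [III] Theorem p.245, Thm 1 p.262, Thm 2 p.263, §2 p.262, §3 pp.264–265, (3.1) p.264, (3.5) p.265, (3.16)–(3.21) pp.268–269, (3.23)–(3.25) p.270, §3 p.279,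
(2.17)–(2.18) p.257, (2.20)–(2.31) pp.258–260, (2.40)–(2.42) p.261; [I] Thm 1 p.258; [IV] (0.2)–(0.4) p.176, p.177 (i)–(ii).
-/

noncomputable section

open MeasureTheory
open scoped BigOperators ENNReal NNReal Matrix.Norms.L2Operator

namespace Summit.QuantumFields.YangMills.Theorems.BalabanUVNodesN11SupplyChainFirstStepSupplier

open Literature.MathematicalPhysics.QuantumFieldTheory.Balaban1983to89 T4Continuum Node00 Node00.Tk
open B10Eq42TorusConstraint (bondsIn)
open Literature.MathematicalPhysics.QuantumFieldTheory.Balaban1983to89.B16RLeafRecord13AtLive (E0_nonneg_theta13LiveOfFamily)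
open BalabanUVNodesN11HistoryPinnedResidualDefs (ZhPinOfRecord₁₃)
open BalabanUVNodesN11FluctTruncationDefs (IsFluctLocal)
open BalabanUVNodesN11Sect3SupplyChainDefs
open BalabanUVNodesN11Sect3SupplyChainObligationsDefs
open BalabanUVNodesN11Sect3SupplyChainNode (sLaw₁₃CoPH_all_of_obligations_of_rows sLaw₁₃CoPH_all_of_obligations_of_gaussCert
  sLaw₁₃CoPH_all_theta13LiveOfRecordH_of_obligations_of_rows sLaw₁₃CoPH_all_gaussCertH_theta13LiveOfRecord_of_obligations_of_operandRows)
open BalabanUVNodesN11Sect3SupplyChainZero (newEClausesAt_zero)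
open BalabanUVNodesN11Sect3SupplyChainTermRows (TermRowsAt SupplierTermRows termRowsAt_zero operandRowsAlongChain_of_supplierTermRows)
open BalabanUVNodesN11SupplyChainFirstLink

variable {F : T4Family} {N : ℕ} [NeZero N]

/-! ## §1. Along its own chain: the first-step supplier's locality and term rows are `u`'s; def-T's operand rows from them -/

section Unfold

variable (θ : Stage13HParams F N) (p : B12.RunParams)
variable (u : SeqOfRecord F θ.ν θ.τ9.M (gOfRecord₁₃ F N θ.toStage13Params p) p.K 1 → Sect2.TermValues (F.P p.K) (MatA N) (FluctV N) θ.τ9.M)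
  (E₁ : SeqOfRecord F θ.ν θ.τ9.M (gOfRecord₁₃ F N θ.toStage13Params p) p.K 1 → ℝ)

/-- **THE (loc) FIELD FOR THE FIRST-STEP SUPPLIER IS `1`-LOCALITY OF `u`**: its responses along its chain are `(k+1)`-local in the fluctuation variables at every level iff `u s` is
`1`-local at every history of length `1` (the zero responses above read nothing).  NO absence hypothesis. [cite: Balaban1988Convergent, (2.40)–(2.41) p.261, (3.24) p.270 (bookkeeping)] -/
theorem loc_firstStepSupplier_iff :
    (∀ (k : ℕ) (s : SeqOfRecord F θ.ν θ.τ9.M (gOfRecord₁₃ F N θ.toStage13Params p) p.K (k + 1)),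
        IsFluctLocal (k + 1) ((firstStepSupplier θ p u E₁ k (chainWitness θ p (firstStepSupplier θ p u E₁) k).1 (chainWitness θ p (firstStepSupplier θ p u E₁) k).2).1 s)) ↔
      ∀ s : SeqOfRecord F θ.ν θ.τ9.M (gOfRecord₁₃ F N θ.toStage13Params p) p.K 1, IsFluctLocal 1 (u s) := by
  refine ⟨fun h s => h 0 s, fun h k s => ?_⟩
  cases k with
  | zero => exact h s
  | succ k => exact ⟨fun _ _ _ _ _ _ _ => rfl⟩  -- zero term values: their `𝐁` is zero

/-- **THE FIRST-STEP SUPPLIER's TERM ROWS ALONG ITS CHAIN ARE THE TERM ROWS OF `u`** at the levels `1 ≤ j` (dag-n11-w3's `SupplierTermRows`; the zero responses above have the zero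
rows `termRowsAt_zero`).  NO absence hypothesis. [cite: Balaban1988Convergent, (2.23)–(2.27) pp.258–259, (2.30)–(2.31) p.260, (2.40)–(2.41) p.261, (3.16)–(3.21) pp.268–269 (bookkeeping)] -/
theorem supplierTermRows_firstStepSupplier_iff :
    SupplierTermRows θ p (firstStepSupplier θ p u E₁) ↔
      ∀ (s : SeqOfRecord F θ.ν θ.τ9.M (gOfRecord₁₃ F N θ.toStage13Params p) p.K 1) (j : ℕ), 1 ≤ j → TermRowsAt θ p (u s) j := by
  refine ⟨fun h s j hj => h 0 s j hj, fun h k s j hj => ?_⟩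
  cases k with
  | zero => exact h s j hj
  | succ k => exact termRowsAt_zero j

/-- **def-T's OPERAND ROWS ALONG THE FIRST-STEP SUPPLIER's CHAIN FROM THE TERM ROWS OF `u`** (dag-n11-w3's ★★★ `operandRowsAlongChain_of_supplierTermRows`).  NO absence hypothesis.
[cite: Balaban1988Convergent, (2.20)–(2.23) p.258, (3.16)–(3.21) pp.268–269, (3.24) p.270] -/
theorem operandRowsAlongChain_firstStepSupplier
    (hrows : ∀ (s : SeqOfRecord F θ.ν θ.τ9.M (gOfRecord₁₃ F N θ.toStage13Params p) p.K 1) (j : ℕ), 1 ≤ j → TermRowsAt θ p (u s) j) :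
    OperandRowsAlongChain θ p (firstStepSupplier θ p u E₁) :=
  operandRowsAlongChain_of_supplierTermRows ((supplierTermRows_firstStepSupplier_iff θ p u E₁).mpr hrows)

end Unfold

/-! ## §2. The first-step supplier meets the obligations in a run with no 𝐓-present expansion child above the first level; every supplier is matched by one -/

section Generic

variable {θ : Stage13HParams F N} {p : B12.RunParams}
variable (u : SeqOfRecord F θ.ν θ.τ9.M (gOfRecord₁₃ F N θ.toStage13Params p) p.K 1 → Sect2.TermValues (F.P p.K) (MatA N) (FluctV N) θ.τ9.M)
  (E₁ : SeqOfRecord F θ.ν θ.τ9.M (gOfRecord₁₃ F N θ.toStage13Params p) p.K 1 → ℝ)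

/-- **★ THE FIRST-STEP SUPPLIER MEETS `SupplierObligations` IN A RUN WITH NO 𝐓-PRESENT EXPANSION CHILD ABOVE THE FIRST LEVEL** from `1`-locality of `u` and (`0 < K`) the first
link: at `k = 0` the fields ARE the first link ((present) through p597418's ★ `presentChildObligations_zero_iff`); at `k ≥ 1` the zero response is `(k+1)`-local, universal in 𝐄
(a constant family), has the four 𝐄-clauses (`0 ≤ E₀`; dag-n11-e's `newEClausesAt_zero`), and owes nothing at the expansion children — all 𝐓-absent by hypothesis.
[cite: Balaban1988Convergent, Thm 1 p.262, Thm 2 p.263, §3 p.279, (3.24)–(3.25) p.270, (2.25)–(2.28) p.259, (2.40)–(2.41) p.261; Balaban1987RG1, Thm 1 p.258] -/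
theorem supplierObligations_firstStepSupplier (hE₀ : 0 ≤ θ.s2.lf.E₀)
    (habs : ∀ k, 1 ≤ k → k < p.K → ∀ s : SeqOfRecord F θ.ν θ.τ9.M (gOfRecord₁₃ F N θ.toStage13Params p) p.K (k + 1), s.Ω (k + 1) ≠ ∅ →
      slotsTOfRecord F N θ.ν θ.τ9 (EOfRecord₁₃ F N θ.toStage13Params) (wOfRecord₉ F N θ.toStage9Params) θ.ppSel p (gOfRecord₁₃ F N θ.toStage13Params p) (k + 1) s = 0)
    (hloc : ∀ s : SeqOfRecord F θ.ν θ.τ9.M (gOfRecord₁₃ F N θ.toStage13Params p) p.K 1, IsFluctLocal 1 (u s))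
    (hlink : 0 < p.K → FirstLinkObligations θ p (firstStepSupplier θ p u E₁)) : SupplierObligations θ p (firstStepSupplier θ p u E₁) where
  loc := (loc_firstStepSupplier_iff θ p u E₁).mpr hloc
  univE := fun k hk _ => by
    cases k with
    | zero => exact (hlink hk).univE
    | succ k => exact Sect2.universalE_const _
  newE := fun k hk _ s => by
    cases k with
    | zero => exact (hlink hk).newE s
    | succ k => exact newEClausesAt_zero hE₀ (k + 1) s
  present := fun k hk _ s hΩ hT => by
    cases k with
    | zero => exact (presentChildObligations_zero_iff _ _ _ s).mpr ((hlink hk).present s hΩ hT)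
    | succ k => exact absurd (habs (k + 1) (Nat.succ_pos k) hk s hΩ) hT

/-- **★ … IFF**: in such a run (`0 ≤ E₀`), `SupplierObligations θ p (firstStepSupplier θ p u E₁)` ⟺ «`u` is `1`-local at every history ∧ (`0 < K` → the first link)».
[cite: Balaban1988Convergent, Thm 1 p.262, §3 p.279, (3.24)–(3.25) p.270, (2.40)–(2.41) p.261; Balaban1987RG1, Thm 1 p.258] -/
theorem supplierObligations_firstStepSupplier_iff (hE₀ : 0 ≤ θ.s2.lf.E₀)
    (habs : ∀ k, 1 ≤ k → k < p.K → ∀ s : SeqOfRecord F θ.ν θ.τ9.M (gOfRecord₁₃ F N θ.toStage13Params p) p.K (k + 1), s.Ω (k + 1) ≠ ∅ →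
      slotsTOfRecord F N θ.ν θ.τ9 (EOfRecord₁₃ F N θ.toStage13Params) (wOfRecord₉ F N θ.toStage9Params) θ.ppSel p (gOfRecord₁₃ F N θ.toStage13Params p) (k + 1) s = 0)
    :
    SupplierObligations θ p (firstStepSupplier θ p u E₁) ↔
      (∀ s : SeqOfRecord F θ.ν θ.τ9.M (gOfRecord₁₃ F N θ.toStage13Params p) p.K 1, IsFluctLocal 1 (u s)) ∧
      (0 < p.K → FirstLinkObligations θ p (firstStepSupplier θ p u E₁)) :=
  ⟨fun h => ⟨fun s => h.loc 0 s, fun hK => firstLinkObligations_of_supplierObligations h hK⟩,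
    fun h => supplierObligations_firstStepSupplier u E₁ hE₀ habs h.1 h.2⟩

/-- **★ … IN THE FIRST-STEP DATA's OWN LETTERS** (p597418's `firstLinkObligations_firstStepSupplier_iff`): in such a run (`0 ≤ E₀`), the first-step supplier meets
`SupplierObligations` ⟺ «`u s` `1`-local at every `s` ∧ (`0 < K` → `u` universal in 𝐄 ∧ the four level-`1` 𝐄-clauses for `u s` at every `s` ∧ the first-step clauses for
`(u s, E₁ s)` at every 𝐓-present expansion pair)» — [I] Thm 1 + [II] at def-T's level-1 objects, as data.
[cite: Balaban1988Convergent, Thm 1 p.262, Thm 2 p.263, §3 p.279, (3.1) p.264, (3.25) p.270, (2.25)–(2.28) p.259, (2.40)–(2.41) p.261; Balaban1987RG1, Thm 1 p.258] -/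
theorem supplierObligations_firstStepSupplier_iff_data (hE₀ : 0 ≤ θ.s2.lf.E₀)
    (habs : ∀ k, 1 ≤ k → k < p.K → ∀ s : SeqOfRecord F θ.ν θ.τ9.M (gOfRecord₁₃ F N θ.toStage13Params p) p.K (k + 1), s.Ω (k + 1) ≠ ∅ →
      slotsTOfRecord F N θ.ν θ.τ9 (EOfRecord₁₃ F N θ.toStage13Params) (wOfRecord₉ F N θ.toStage9Params) θ.ppSel p (gOfRecord₁₃ F N θ.toStage13Params p) (k + 1) s = 0)
    :
    SupplierObligations θ p (firstStepSupplier θ p u E₁) ↔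
      (∀ s : SeqOfRecord F θ.ν θ.τ9.M (gOfRecord₁₃ F N θ.toStage13Params p) p.K 1, IsFluctLocal 1 (u s)) ∧
      (0 < p.K →
        Sect2.UniversalE u ∧
        (∀ s : SeqOfRecord F θ.ν θ.τ9.M (gOfRecord₁₃ F N θ.toStage13Params p) p.K 1, NewEClausesAt θ p 0 (u s) s) ∧
        (∀ s : SeqOfRecord F θ.ν θ.τ9.M (gOfRecord₁₃ F N θ.toStage13Params p) p.K 1, s.Ω 1 ≠ ∅ →
          slotsTOfRecord F N θ.ν θ.τ9 (EOfRecord₁₃ F N θ.toStage13Params) (wOfRecord₉ F N θ.toStage9Params) θ.ppSel p (gOfRecord₁₃ F N θ.toStage13Params p) 1 s ≠ 0 →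
            FirstStepClausesAt θ p s (u s) (E₁ s))) := by
  rw [supplierObligations_firstStepSupplier_iff u E₁ hE₀ habs, firstLinkObligations_firstStepSupplier_iff θ p u E₁]

/-- **THE FIRST LINK READS THE LEVEL-`0` RESPONSE ONLY**: a supplier `σ` carries the first link iff the first-step supplier of ITS OWN level-`0` response
`σ 0 (baseWitness θ p).1 (baseWitness θ p).2` does (both chains start at def-T's base witness, `chainWitness_zero`). [cite: Balaban1988Convergent, §3 pp.264–265, §3 p.279 (bookkeeping)] -/
theorem firstLinkObligations_firstStepSupplier_response_iff (σ : Sect3Supplier θ p) :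
    FirstLinkObligations θ p (firstStepSupplier θ p (σ 0 (baseWitness θ p).1 (baseWitness θ p).2).1 (σ 0 (baseWitness θ p).1 (baseWitness θ p).2).2) ↔
      FirstLinkObligations θ p σ :=
  ⟨fun h => ⟨h.univE, h.newE, h.present⟩, fun h => ⟨h.univE, h.newE, h.present⟩⟩

/-- **★ EVERY SUPPLIER MEETING ITS OBLIGATIONS IS MATCHED BY A FIRST-STEP SUPPLIER** in such a run (`0 ≤ E₀`): the first-step supplier of `σ`'s own level-`0` response meets
`SupplierObligations` too (its (loc) at `0` and its first link are `σ`'s; above it owes nothing). [cite: Balaban1988Convergent, Thm 1 p.262, §3 p.279, (3.24)–(3.25) p.270 (bookkeeping)] -/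
theorem supplierObligations_firstStepSupplier_of_supplierObligations (hE₀ : 0 ≤ θ.s2.lf.E₀)
    (habs : ∀ k, 1 ≤ k → k < p.K → ∀ s : SeqOfRecord F θ.ν θ.τ9.M (gOfRecord₁₃ F N θ.toStage13Params p) p.K (k + 1), s.Ω (k + 1) ≠ ∅ →
      slotsTOfRecord F N θ.ν θ.τ9 (EOfRecord₁₃ F N θ.toStage13Params) (wOfRecord₉ F N θ.toStage9Params) θ.ppSel p (gOfRecord₁₃ F N θ.toStage13Params p) (k + 1) s = 0)
    {σ : Sect3Supplier θ p} (hσ : SupplierObligations θ p σ) :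
    SupplierObligations θ p (firstStepSupplier θ p (σ 0 (baseWitness θ p).1 (baseWitness θ p).2).1 (σ 0 (baseWitness θ p).1 (baseWitness θ p).2).2) :=
  supplierObligations_firstStepSupplier _ _ hE₀ habs (fun s => hσ.loc 0 s) fun hK =>
    (firstLinkObligations_firstStepSupplier_response_iff σ).mpr (firstLinkObligations_of_supplierObligations hσ hK)

/-- **★★ IN A RUN WITH NO 𝐓-PRESENT EXPANSION CHILD ABOVE THE FIRST LEVEL, THE SUPPLIER SIDE OF N11's TOKEN IS FIRST-STEP DATA — NOTHING ELSE** (`0 ≤ E₀`):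
`(∃ σ, SupplierObligations θ p σ)` ⟺ «SOME `u, E₁` with `u s` `1`-local at every `s` and (`0 < K` →) `u` universal in 𝐄, the four level-`1` 𝐄-clauses at every history, the
first-step clauses at every 𝐓-present expansion pair» = [I] Thm 1 + [II] at def-T's level-1 objects (plus locality), as data.  (The no-expansion half of the token stays
chain-keyed: §4 discharges it for the first-step supplier's chain from the rows.)
[cite: Balaban1988Convergent, Thm 1 p.262, Thm 2 p.263, §3 p.279, (3.1) p.264, (3.25) p.270, (2.25)–(2.28) p.259, (2.40)–(2.41) p.261; Balaban1987RG1, Thm 1 p.258] -/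
theorem exists_supplierObligations_iff_exists_firstStepData (hE₀ : 0 ≤ θ.s2.lf.E₀)
    (habs : ∀ k, 1 ≤ k → k < p.K → ∀ s : SeqOfRecord F θ.ν θ.τ9.M (gOfRecord₁₃ F N θ.toStage13Params p) p.K (k + 1), s.Ω (k + 1) ≠ ∅ →
      slotsTOfRecord F N θ.ν θ.τ9 (EOfRecord₁₃ F N θ.toStage13Params) (wOfRecord₉ F N θ.toStage9Params) θ.ppSel p (gOfRecord₁₃ F N θ.toStage13Params p) (k + 1) s = 0) :
    (∃ σ : Sect3Supplier θ p, SupplierObligations θ p σ) ↔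
      ∃ (u : SeqOfRecord F θ.ν θ.τ9.M (gOfRecord₁₃ F N θ.toStage13Params p) p.K 1 → Sect2.TermValues (F.P p.K) (MatA N) (FluctV N) θ.τ9.M)
        (E₁ : SeqOfRecord F θ.ν θ.τ9.M (gOfRecord₁₃ F N θ.toStage13Params p) p.K 1 → ℝ),
        (∀ s : SeqOfRecord F θ.ν θ.τ9.M (gOfRecord₁₃ F N θ.toStage13Params p) p.K 1, IsFluctLocal 1 (u s)) ∧
        (0 < p.K →
          Sect2.UniversalE u ∧
          (∀ s : SeqOfRecord F θ.ν θ.τ9.M (gOfRecord₁₃ F N θ.toStage13Params p) p.K 1, NewEClausesAt θ p 0 (u s) s) ∧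
          (∀ s : SeqOfRecord F θ.ν θ.τ9.M (gOfRecord₁₃ F N θ.toStage13Params p) p.K 1, s.Ω 1 ≠ ∅ →
            slotsTOfRecord F N θ.ν θ.τ9 (EOfRecord₁₃ F N θ.toStage13Params) (wOfRecord₉ F N θ.toStage9Params) θ.ppSel p (gOfRecord₁₃ F N θ.toStage13Params p) 1 s ≠ 0 →
              FirstStepClausesAt θ p s (u s) (E₁ s))) := by
  constructor
  · rintro ⟨σ, hσ⟩
    exact ⟨_, _, (supplierObligations_firstStepSupplier_iff_data _ _ hE₀ habs).mp (supplierObligations_firstStepSupplier_of_supplierObligations hE₀ habs hσ)⟩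
  · rintro ⟨u, E₁, h⟩
    exact ⟨_, (supplierObligations_firstStepSupplier_iff_data u E₁ hE₀ habs).mpr h⟩

/-! ## §3∕§4. The no-expansion obligation of the first-step supplier's chain discharged from the rows; the token from first-step data + rows -/

/-- **THE NO-EXPANSION OBLIGATION OF THE FIRST-STEP SUPPLIER's CHAIN FROM THE ROWS** (dag-n11-d's road, through dag-n11-e's `noExpansionObligation_of_residualRows_of_operandRows`):
core provisos, `ZhUnity`, `1 ≤ M`, `1`-locality of `u`, the witness-free `ResidualRows θ p`, and `u`'s term rows (§1: def-T's operand rows along this chain).  NO absence hypothesis.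
[cite: Balaban1988Convergent, Theorem p.245, (3.24)–(3.25) p.270, (3.1) p.264, (3.16)–(3.21) pp.268–269; Balaban1989LargeFieldI, (0.2)–(0.3) p.176] -/
theorem noExpansionObligation_firstStepSupplier_of_residualRows (h : θ.Provisos₁₃CoPH F N) (hU : θ.ZhUnity F N) (hM : 1 ≤ θ.τ9.M)
    (hloc : ∀ s : SeqOfRecord F θ.ν θ.τ9.M (gOfRecord₁₃ F N θ.toStage13Params p) p.K 1, IsFluctLocal 1 (u s)) (hres : ResidualRows θ p)
    (hrows : ∀ (s : SeqOfRecord F θ.ν θ.τ9.M (gOfRecord₁₃ F N θ.toStage13Params p) p.K 1) (j : ℕ), 1 ≤ j → TermRowsAt θ p (u s) j) :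
    NoExpansionObligation θ p (firstStepSupplier θ p u E₁) :=
  noExpansionObligation_of_residualRows_of_operandRows h hU hM _ ((loc_firstStepSupplier_iff θ p u E₁).mpr hloc) hres
    (operandRowsAlongChain_firstStepSupplier θ p u E₁ hrows)

/-- **THE NO-EXPANSION OBLIGATION OF THE FIRST-STEP SUPPLIER's CHAIN AT ANY `θ` OF THE GAUSSIAN-CERTIFICATE CLASS FROM `u`'s TERM ROWS ALONE** (dag-n11-w1's road, through
dag-n11-e's ★★ `noExpansionObligation_of_gaussCert_of_operandRows`): certificate `ζ0`, A-fibre Gaussian `quad`, core provisos, `1 ≤ M`, `1`-locality of `u`.  NO absence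
hypothesis, no `ZhUnity`, no residual row. [cite: Balaban1988Convergent, Theorem p.245, Thm 1 p.262, (3.23)–(3.25) p.270, (2.23) p.258] -/
theorem noExpansionObligation_firstStepSupplier_of_gaussCert
    (hζ : ∀ (p : B12.RunParams) (n : ℕ) (Ω Λ : ℕ → Set (Site (F.P p.K) 0)), (θ.Zh p n Ω Λ).ζ0 = (ZhPinOfRecord₁₃ θ.toStage13Params p Ω Λ).ζ0)
    (hq : ∀ (p : B12.RunParams) (n : ℕ) (Ω Λ : ℕ → Set (Site (F.P p.K) 0)) (j : ℕ) (Λ' : Set (Site (F.P p.K) 0)) (ω : MultiCfg (F.P p.K) (SU N) (FluctV N)),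
      (θ.Zh p n Ω Λ).quad j Λ' ω = ∑ b ∈ (Set.toFinite (bondsIn j (Λ'ᶜ ∩ Ω (j + 1)))).toFinset, ‖(ω j).2 b‖ ^ 2)
    (h : θ.Provisos₁₃CoPH F N) (hM : 1 ≤ θ.τ9.M)
    (hloc : ∀ s : SeqOfRecord F θ.ν θ.τ9.M (gOfRecord₁₃ F N θ.toStage13Params p) p.K 1, IsFluctLocal 1 (u s))
    (hrows : ∀ (s : SeqOfRecord F θ.ν θ.τ9.M (gOfRecord₁₃ F N θ.toStage13Params p) p.K 1) (j : ℕ), 1 ≤ j → TermRowsAt θ p (u s) j) :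
    NoExpansionObligation θ p (firstStepSupplier θ p u E₁) :=
  noExpansionObligation_of_gaussCert_of_operandRows hζ hq h hM _ ((loc_firstStepSupplier_iff θ p u E₁).mpr hloc) (operandRowsAlongChain_firstStepSupplier θ p u E₁ hrows)

/-- **★ N11's ONE-TOKEN RESIDUAL `SupplyChainAt θ p` IN A RUN WITH NO 𝐓-PRESENT EXPANSION CHILD ABOVE THE FIRST LEVEL, FROM FIRST-STEP DATA AND THE NO-EXPANSION OBLIGATION OF
THE FIRST-STEP SUPPLIER's CHAIN** (`0 ≤ E₀`): the first-step supplier inhabits the token. [cite: Balaban1988Convergent, Thm 1 p.262, Theorem p.245, §3 p.279, (3.25) p.270; Balaban1987RG1, Thm 1 p.258] -/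
theorem supplyChainAt_of_firstStepSupplier (hE₀ : 0 ≤ θ.s2.lf.E₀)
    (habs : ∀ k, 1 ≤ k → k < p.K → ∀ s : SeqOfRecord F θ.ν θ.τ9.M (gOfRecord₁₃ F N θ.toStage13Params p) p.K (k + 1), s.Ω (k + 1) ≠ ∅ →
      slotsTOfRecord F N θ.ν θ.τ9 (EOfRecord₁₃ F N θ.toStage13Params) (wOfRecord₉ F N θ.toStage9Params) θ.ppSel p (gOfRecord₁₃ F N θ.toStage13Params p) (k + 1) s = 0)
    (hloc : ∀ s : SeqOfRecord F θ.ν θ.τ9.M (gOfRecord₁₃ F N θ.toStage13Params p) p.K 1, IsFluctLocal 1 (u s))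
    (hlink : 0 < p.K → FirstLinkObligations θ p (firstStepSupplier θ p u E₁)) (hT : NoExpansionObligation θ p (firstStepSupplier θ p u E₁)) : SupplyChainAt θ p :=
  ⟨firstStepSupplier θ p u E₁, supplierObligations_firstStepSupplier u E₁ hE₀ habs hloc hlink, hT⟩

/-- **★★ N11's TOKEN IN SUCH A RUN FROM FIRST-STEP DATA + THE ROWS** (generic `θ`: core provisos, `ZhUnity`, `1 ≤ M`, `0 ≤ E₀`; `ResidualRows θ p` witness-free; `u`'s term rows).
[cite: Balaban1988Convergent, Thm 1 p.262, Theorem p.245, §3 p.279, (3.24)–(3.25) p.270, (3.16)–(3.21) pp.268–269; Balaban1987RG1, Thm 1 p.258; Balaban1989LargeFieldI, (0.2)–(0.3) p.176] -/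
theorem supplyChainAt_of_firstStepSupplier_of_residualRows (h : θ.Provisos₁₃CoPH F N) (hU : θ.ZhUnity F N) (hM : 1 ≤ θ.τ9.M) (hE₀ : 0 ≤ θ.s2.lf.E₀)
    (habs : ∀ k, 1 ≤ k → k < p.K → ∀ s : SeqOfRecord F θ.ν θ.τ9.M (gOfRecord₁₃ F N θ.toStage13Params p) p.K (k + 1), s.Ω (k + 1) ≠ ∅ →
      slotsTOfRecord F N θ.ν θ.τ9 (EOfRecord₁₃ F N θ.toStage13Params) (wOfRecord₉ F N θ.toStage9Params) θ.ppSel p (gOfRecord₁₃ F N θ.toStage13Params p) (k + 1) s = 0)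
    (hloc : ∀ s : SeqOfRecord F θ.ν θ.τ9.M (gOfRecord₁₃ F N θ.toStage13Params p) p.K 1, IsFluctLocal 1 (u s))
    (hlink : 0 < p.K → FirstLinkObligations θ p (firstStepSupplier θ p u E₁)) (hres : ResidualRows θ p)
    (hrows : ∀ (s : SeqOfRecord F θ.ν θ.τ9.M (gOfRecord₁₃ F N θ.toStage13Params p) p.K 1) (j : ℕ), 1 ≤ j → TermRowsAt θ p (u s) j) : SupplyChainAt θ p :=
  supplyChainAt_of_firstStepSupplier u E₁ hE₀ habs hloc hlink (noExpansionObligation_firstStepSupplier_of_residualRows u E₁ h hU hM hloc hres hrows)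

/-! ## §5. Theorem 1 of [III] in a run with no 𝐓-present expansion child above the first level, from first-step data and the rows -/

/-- **★★ THEOREM 1 OF [III] AT A GENERIC `θ`, ALL LEVELS, ALL HISTORIES, IN A RUN WITH NO 𝐓-PRESENT EXPANSION CHILD ABOVE THE FIRST LEVEL — FROM FIRST-STEP DATA, THE WITNESS-FREE
RESIDUAL ROWS AND `u`'s TERM ROWS** on the live-selector line (core provisos, `ZhUnity`, selector clause, admissibility, `0 ≤ κ, E₀, B₀`, `1 ≤ M`): dag-n11-e's
`sLaw₁₃CoPH_all_of_obligations_of_rows` along the first-step supplier's chain (§2 the obligations, §1 the operand rows).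
[cite: Balaban1988Convergent, Thm 1 p.262, Theorem p.245, Thm 2 p.263, §3 p.279, (3.24)–(3.25) p.270, (3.16)–(3.21) pp.268–269; Balaban1987RG1, Thm 1 p.258; Balaban1989LargeFieldI, (0.2)–(0.4) p.176, p.177 (i)–(ii)] -/
theorem sLaw₁₃CoPH_all_of_firstStepSupplier_of_residualRows (h : θ.Provisos₁₃CoPH F N) (hU : θ.ZhUnity F N)
    (hsel : θ.ppSel = ppSelLiveOfRecord F N θ.ν θ.τ9 (EOfRecord₁₃ F N θ.toStage13Params) (wOfRecord₉ F N θ.toStage9Params))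
    (hθ : θ.Admissible F N) (hκ : 0 ≤ θ.s2.lf.κ) (hE₀ : 0 ≤ θ.s2.lf.E₀) (hB₀ : 0 ≤ θ.s2.lf.B₀) (hM : 1 ≤ θ.τ9.M)
    (habs : ∀ k, 1 ≤ k → k < p.K → ∀ s : SeqOfRecord F θ.ν θ.τ9.M (gOfRecord₁₃ F N θ.toStage13Params p) p.K (k + 1), s.Ω (k + 1) ≠ ∅ →
      slotsTOfRecord F N θ.ν θ.τ9 (EOfRecord₁₃ F N θ.toStage13Params) (wOfRecord₉ F N θ.toStage9Params) θ.ppSel p (gOfRecord₁₃ F N θ.toStage13Params p) (k + 1) s = 0)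
    (hloc : ∀ s : SeqOfRecord F θ.ν θ.τ9.M (gOfRecord₁₃ F N θ.toStage13Params p) p.K 1, IsFluctLocal 1 (u s))
    (hlink : 0 < p.K → FirstLinkObligations θ p (firstStepSupplier θ p u E₁)) (hres : ResidualRows θ p)
    (hrows : ∀ (s : SeqOfRecord F θ.ν θ.τ9.M (gOfRecord₁₃ F N θ.toStage13Params p) p.K 1) (j : ℕ), 1 ≤ j → TermRowsAt θ p (u s) j) :
    ∀ k, k ≤ p.K → SLaw₁₃CoPH F N θ p k :=
  sLaw₁₃CoPH_all_of_obligations_of_rows h hU hsel hθ hκ hE₀ hB₀ hM _ (supplierObligations_firstStepSupplier u E₁ hE₀ habs hloc hlink) hres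
    (operandRowsAlongChain_firstStepSupplier θ p u E₁ hrows)

/-- **★★ THEOREM 1 OF [III] AT ANY `θ` OF THE GAUSSIAN-CERTIFICATE CLASS, ALL LEVELS, IN SUCH A RUN — FROM FIRST-STEP DATA AND `u`'s TERM ROWS, NOTHING OF THE NO-EXPANSION LANE**
(certificate `ζ0`, A-fibre Gaussian `quad`; live-selector line; core provisos): dag-n11-e's `sLaw₁₃CoPH_all_of_obligations_of_gaussCert` along the first-step supplier's chain.
[cite: Balaban1988Convergent, Thm 1 p.262, Theorem p.245, §3 p.279, (3.23)–(3.25) p.270; Balaban1987RG1, Thm 1 p.258; Balaban1989LargeFieldI, (0.2)–(0.4) p.176, p.177 (i)–(ii)] -/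
theorem sLaw₁₃CoPH_all_of_firstStepSupplier_of_gaussCert
    (hζ : ∀ (p : B12.RunParams) (n : ℕ) (Ω Λ : ℕ → Set (Site (F.P p.K) 0)), (θ.Zh p n Ω Λ).ζ0 = (ZhPinOfRecord₁₃ θ.toStage13Params p Ω Λ).ζ0)
    (hq : ∀ (p : B12.RunParams) (n : ℕ) (Ω Λ : ℕ → Set (Site (F.P p.K) 0)) (j : ℕ) (Λ' : Set (Site (F.P p.K) 0)) (ω : MultiCfg (F.P p.K) (SU N) (FluctV N)),
      (θ.Zh p n Ω Λ).quad j Λ' ω = ∑ b ∈ (Set.toFinite (bondsIn j (Λ'ᶜ ∩ Ω (j + 1)))).toFinset, ‖(ω j).2 b‖ ^ 2)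
    (h : θ.Provisos₁₃CoPH F N)
    (hsel : θ.ppSel = ppSelLiveOfRecord F N θ.ν θ.τ9 (EOfRecord₁₃ F N θ.toStage13Params) (wOfRecord₉ F N θ.toStage9Params))
    (hθ : θ.Admissible F N) (hκ : 0 ≤ θ.s2.lf.κ) (hE₀ : 0 ≤ θ.s2.lf.E₀) (hB₀ : 0 ≤ θ.s2.lf.B₀) (hM : 1 ≤ θ.τ9.M)
    (habs : ∀ k, 1 ≤ k → k < p.K → ∀ s : SeqOfRecord F θ.ν θ.τ9.M (gOfRecord₁₃ F N θ.toStage13Params p) p.K (k + 1), s.Ω (k + 1) ≠ ∅ →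
      slotsTOfRecord F N θ.ν θ.τ9 (EOfRecord₁₃ F N θ.toStage13Params) (wOfRecord₉ F N θ.toStage9Params) θ.ppSel p (gOfRecord₁₃ F N θ.toStage13Params p) (k + 1) s = 0)
    (hloc : ∀ s : SeqOfRecord F θ.ν θ.τ9.M (gOfRecord₁₃ F N θ.toStage13Params p) p.K 1, IsFluctLocal 1 (u s))
    (hlink : 0 < p.K → FirstLinkObligations θ p (firstStepSupplier θ p u E₁))
    (hrows : ∀ (s : SeqOfRecord F θ.ν θ.τ9.M (gOfRecord₁₃ F N θ.toStage13Params p) p.K 1) (j : ℕ), 1 ≤ j → TermRowsAt θ p (u s) j) :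
    ∀ k, k ≤ p.K → SLaw₁₃CoPH F N θ p k :=
  sLaw₁₃CoPH_all_of_obligations_of_gaussCert hζ hq h hsel hθ hκ hE₀ hB₀ hM _ (supplierObligations_firstStepSupplier u E₁ hE₀ habs hloc hlink)
    (operandRowsAlongChain_firstStepSupplier θ p u E₁ hrows)

/-- **★ THE THEOREM OF p. 245 IN LAW FORM — `∀ k < K, SLaw₁₃CoPH θ p k → TLaw₁₃CoPH θ p k` (the `h11`-consequent) — IN SUCH A RUN FROM FIRST-STEP DATA, THE RESIDUAL ROWS AND `u`'s
TERM ROWS** (generic `θ`, live-selector line): dag-n11-e's `thmP245Laws_of_supplyChainAt` at §4's token. [cite: Balaban1988Convergent, Theorem p.245, Thm 1 p.262, remark p.262, (3.25) p.270; Balaban1987RG1, Thm 1 p.258] -/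
theorem thmP245Laws_of_firstStepSupplier_of_residualRows (h : θ.Provisos₁₃CoPH F N) (hU : θ.ZhUnity F N)
    (hsel : θ.ppSel = ppSelLiveOfRecord F N θ.ν θ.τ9 (EOfRecord₁₃ F N θ.toStage13Params) (wOfRecord₉ F N θ.toStage9Params))
    (hθ : θ.Admissible F N) (hκ : 0 ≤ θ.s2.lf.κ) (hE₀ : 0 ≤ θ.s2.lf.E₀) (hB₀ : 0 ≤ θ.s2.lf.B₀) (hM : 1 ≤ θ.τ9.M)
    (habs : ∀ k, 1 ≤ k → k < p.K → ∀ s : SeqOfRecord F θ.ν θ.τ9.M (gOfRecord₁₃ F N θ.toStage13Params p) p.K (k + 1), s.Ω (k + 1) ≠ ∅ →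
      slotsTOfRecord F N θ.ν θ.τ9 (EOfRecord₁₃ F N θ.toStage13Params) (wOfRecord₉ F N θ.toStage9Params) θ.ppSel p (gOfRecord₁₃ F N θ.toStage13Params p) (k + 1) s = 0)
    (hloc : ∀ s : SeqOfRecord F θ.ν θ.τ9.M (gOfRecord₁₃ F N θ.toStage13Params p) p.K 1, IsFluctLocal 1 (u s))
    (hlink : 0 < p.K → FirstLinkObligations θ p (firstStepSupplier θ p u E₁)) (hres : ResidualRows θ p)
    (hrows : ∀ (s : SeqOfRecord F θ.ν θ.τ9.M (gOfRecord₁₃ F N θ.toStage13Params p) p.K 1) (j : ℕ), 1 ≤ j → TermRowsAt θ p (u s) j) :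
    ∀ k, k < p.K → SLaw₁₃CoPH F N θ p k → TLaw₁₃CoPH F N θ p k :=
  thmP245Laws_of_supplyChainAt h hsel hθ hκ hE₀ hB₀ hM (supplyChainAt_of_firstStepSupplier_of_residualRows u E₁ h hU hM hE₀ habs hloc hlink hres hrows)

/-! ## §6. The corner `K ≤ 1` recovered without `0 ≤ E₀` and without the absence hypothesis -/

/-- **A RUN WITH AT MOST ONE STEP (`K ≤ 1`)**: the first-step supplier meets `SupplierObligations` from `1`-locality of `u` and (`0 < K`) the first link — no `0 ≤ E₀`, no absence
hypothesis (every field above level `0` is void).  With p597418's `firstLinkObligations_firstStepSupplier_iff` this is the ⟸ half of `supplyChainAt_iff_of_K_eq_one`'s supplier side.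
[cite: Balaban1988Convergent, Thm 1 p.262, §3 p.279; Balaban1987RG1, Thm 1 p.258] -/
theorem supplierObligations_firstStepSupplier_of_K_le_one (hK : p.K ≤ 1)
    (hloc : ∀ s : SeqOfRecord F θ.ν θ.τ9.M (gOfRecord₁₃ F N θ.toStage13Params p) p.K 1, IsFluctLocal 1 (u s))
    (hlink : 0 < p.K → FirstLinkObligations θ p (firstStepSupplier θ p u E₁)) : SupplierObligations θ p (firstStepSupplier θ p u E₁) where
  loc := (loc_firstStepSupplier_iff θ p u E₁).mpr hloc
  univE := fun k hk _ => by
    cases k with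
    | zero => exact (hlink hk).univE
    | succ k => exact absurd hk (by omega)
  newE := fun k hk _ s => by
    cases k with
    | zero => exact (hlink hk).newE s
    | succ k => exact absurd hk (by omega)
  present := fun k hk _ s hΩ hT => by
    cases k with
    | zero => exact (presentChildObligations_zero_iff _ _ _ s).mpr ((hlink hk).present s hΩ hT)
    | succ k => exact absurd hk (by omega)

end Generic

/-! ## §7. At the H-extensions of the witness of record: selector, admissibility, signs and `M = 1` discharged -/

section Record

variable (F N)
variable {Zr : (q : B12.RunParams) → TkResidualW F N (FluctV N) q.K}
  {Zh : (q : B12.RunParams) → ℕ → (ℕ → Set (Site (F.P q.K) 0)) → (ℕ → Set (Site (F.P q.K) 0)) → TkResidualW F N (FluctV N) q.K}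
  {Phih : (q : B12.RunParams) → ℕ → (ℕ → Set (Site (F.P q.K) 0)) → (ℕ → Set (Site (F.P q.K) 0)) → (ℕ → Plaq (F.P q.K) 0 → ℝ)} (p : B12.RunParams)

/-- **★★★ THEOREM 1 OF [III] AT ANY GAUSSIAN-CLASS H-EXTENSION OF THE WITNESS OF RECORD, ALL LEVELS, ALL HISTORIES, IN A RUN WITH NO 𝐓-PRESENT EXPANSION CHILD ABOVE THE FIRST
LEVEL — FROM `hrec` (the datum's key), FIRST-STEP DATA AND `u`'s TERM ROWS, NOTHING ELSE**: selector `rfl`, admissibility, the signs and `M = 1` are the family's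
(dag-n11-e's `sLaw₁₃CoPH_all_gaussCertH_theta13LiveOfRecord_of_obligations_of_operandRows`), the obligations and operand rows are the first-step supplier's (§2, §1).  dag-n11-e
proved this from the absence hypothesis at EVERY level (zero supplier); here the first level is LIVE and paid for by the first link.
[cite: Balaban1988Convergent, Thm 1 p.262, Theorem p.245, p.244, §3 p.279, (3.23)–(3.25) p.270, (1.11) p.248, (3.16)–(3.22) pp.268–269; Balaban1987RG1, Thm 1 p.258; Balaban1989LargeFieldI, (0.3)–(0.4) p.176, p.177 (i)–(ii)] -/
theorem sLaw₁₃CoPH_all_gaussCertH_theta13LiveOfRecord_of_firstStepSupplier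
    (hζ : ∀ (p : B12.RunParams) (n : ℕ) (Ω Λ : ℕ → Set (Site (F.P p.K) 0)), (Zh p n Ω Λ).ζ0 = (ZhPinOfRecord₁₃ (theta13LiveOfRecord F N) p Ω Λ).ζ0)
    (hq : ∀ (p : B12.RunParams) (n : ℕ) (Ω Λ : ℕ → Set (Site (F.P p.K) 0)) (j : ℕ) (Λ' : Set (Site (F.P p.K) 0)) (ω : MultiCfg (F.P p.K) (SU N) (FluctV N)),
      (Zh p n Ω Λ).quad j Λ' ω = ∑ b ∈ (Set.toFinite (bondsIn j (Λ'ᶜ ∩ Ω (j + 1)))).toFinset, ‖(ω j).2 b‖ ^ 2)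
    (hrec : (⟨⟨theta13LiveOfRecord F N, Zr⟩, Zh, Phih⟩ : Stage13HParams F N).Provisos₁₃CoPH F N)
    (habs : ∀ k, 1 ≤ k → k < p.K → ∀ s : SeqOfRecord F (theta13LiveOfRecord F N).ν (theta13LiveOfRecord F N).τ9.M (gOfRecord₁₃ F N (theta13LiveOfRecord F N) p) p.K (k + 1),
      s.Ω (k + 1) ≠ ∅ → slotsTOfRecord F N (theta13LiveOfRecord F N).ν (theta13LiveOfRecord F N).τ9 (EOfRecord₁₃ F N (theta13LiveOfRecord F N))
        (wOfRecord₉ F N (theta13LiveOfRecord F N).toStage9Params) (theta13LiveOfRecord F N).ppSel p (gOfRecord₁₃ F N (theta13LiveOfRecord F N) p) (k + 1) s = 0)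
    (u : SeqOfRecord F (theta13LiveOfRecord F N).ν (theta13LiveOfRecord F N).τ9.M (gOfRecord₁₃ F N (theta13LiveOfRecord F N) p) p.K 1 →
      Sect2.TermValues (F.P p.K) (MatA N) (FluctV N) (theta13LiveOfRecord F N).τ9.M)
    (E₁ : SeqOfRecord F (theta13LiveOfRecord F N).ν (theta13LiveOfRecord F N).τ9.M (gOfRecord₁₃ F N (theta13LiveOfRecord F N) p) p.K 1 → ℝ)
    (hloc : ∀ s, IsFluctLocal 1 (u s))
    (hlink : 0 < p.K → FirstLinkObligations (⟨⟨theta13LiveOfRecord F N, Zr⟩, Zh, Phih⟩ : Stage13HParams F N) p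
      (firstStepSupplier (⟨⟨theta13LiveOfRecord F N, Zr⟩, Zh, Phih⟩ : Stage13HParams F N) p u E₁))
    (hrows : ∀ s (j : ℕ), 1 ≤ j → TermRowsAt (⟨⟨theta13LiveOfRecord F N, Zr⟩, Zh, Phih⟩ : Stage13HParams F N) p (u s) j) :
    ∀ k, k ≤ p.K → SLaw₁₃CoPH F N (⟨⟨theta13LiveOfRecord F N, Zr⟩, Zh, Phih⟩ : Stage13HParams F N) p k :=
  sLaw₁₃CoPH_all_gaussCertH_theta13LiveOfRecord_of_obligations_of_operandRows F N p hζ hq hrec _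
    (supplierObligations_firstStepSupplier (θ := (⟨⟨theta13LiveOfRecord F N, Zr⟩, Zh, Phih⟩ : Stage13HParams F N)) u E₁
      (E0_nonneg_theta13LiveOfFamily F N eps0OfRecord₁₃ (zeta316OfRecord F N (numerics7OfFamily eps0OfRecord₁₃) 1 1) (RzOfRecord F N) (ZtOfRecord F N)) habs hloc hlink)
    (operandRowsAlongChain_firstStepSupplier (⟨⟨theta13LiveOfRecord F N, Zr⟩, Zh, Phih⟩ : Stage13HParams F N) p u E₁ hrows)

/-- **★★ THEOREM 1 OF [III] AT ANY H-EXTENSION OF THE WITNESS OF RECORD, ALL LEVELS, IN SUCH A RUN — FROM `hrec`, `ZhUnity`, FIRST-STEP DATA, THE WITNESS-FREE RESIDUAL ROWS AND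
`u`'s TERM ROWS** (dag-n11-e's (t60) corollary `sLaw₁₃CoPH_all_theta13LiveOfRecordH_of_obligations_of_rows` along the first-step supplier's chain).
[cite: Balaban1988Convergent, Thm 1 p.262, Theorem p.245, (3.24)–(3.25) p.270, (3.16)–(3.22) pp.268–269, (1.11) p.248; Balaban1987RG1, Thm 1 p.258; Balaban1989LargeFieldI, (0.3)–(0.4) p.176, p.177 (i)–(ii)] -/
theorem sLaw₁₃CoPH_all_theta13LiveOfRecordH_of_firstStepSupplier_of_rows
    (hrec : (⟨⟨theta13LiveOfRecord F N, Zr⟩, Zh, Phih⟩ : Stage13HParams F N).Provisos₁₃CoPH F N)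
    (hU : (⟨⟨theta13LiveOfRecord F N, Zr⟩, Zh, Phih⟩ : Stage13HParams F N).ZhUnity F N)
    (habs : ∀ k, 1 ≤ k → k < p.K → ∀ s : SeqOfRecord F (theta13LiveOfRecord F N).ν (theta13LiveOfRecord F N).τ9.M (gOfRecord₁₃ F N (theta13LiveOfRecord F N) p) p.K (k + 1),
      s.Ω (k + 1) ≠ ∅ → slotsTOfRecord F N (theta13LiveOfRecord F N).ν (theta13LiveOfRecord F N).τ9 (EOfRecord₁₃ F N (theta13LiveOfRecord F N))
        (wOfRecord₉ F N (theta13LiveOfRecord F N).toStage9Params) (theta13LiveOfRecord F N).ppSel p (gOfRecord₁₃ F N (theta13LiveOfRecord F N) p) (k + 1) s = 0)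
    (u : SeqOfRecord F (theta13LiveOfRecord F N).ν (theta13LiveOfRecord F N).τ9.M (gOfRecord₁₃ F N (theta13LiveOfRecord F N) p) p.K 1 →
      Sect2.TermValues (F.P p.K) (MatA N) (FluctV N) (theta13LiveOfRecord F N).τ9.M)
    (E₁ : SeqOfRecord F (theta13LiveOfRecord F N).ν (theta13LiveOfRecord F N).τ9.M (gOfRecord₁₃ F N (theta13LiveOfRecord F N) p) p.K 1 → ℝ)
    (hloc : ∀ s, IsFluctLocal 1 (u s))
    (hlink : 0 < p.K → FirstLinkObligations (⟨⟨theta13LiveOfRecord F N, Zr⟩, Zh, Phih⟩ : Stage13HParams F N) p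
      (firstStepSupplier (⟨⟨theta13LiveOfRecord F N, Zr⟩, Zh, Phih⟩ : Stage13HParams F N) p u E₁))
    (hres : ResidualRows (⟨⟨theta13LiveOfRecord F N, Zr⟩, Zh, Phih⟩ : Stage13HParams F N) p)
    (hrows : ∀ s (j : ℕ), 1 ≤ j → TermRowsAt (⟨⟨theta13LiveOfRecord F N, Zr⟩, Zh, Phih⟩ : Stage13HParams F N) p (u s) j) :
    ∀ k, k ≤ p.K → SLaw₁₃CoPH F N (⟨⟨theta13LiveOfRecord F N, Zr⟩, Zh, Phih⟩ : Stage13HParams F N) p k :=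
  sLaw₁₃CoPH_all_theta13LiveOfRecordH_of_obligations_of_rows F N p hrec hU _
    (supplierObligations_firstStepSupplier (θ := (⟨⟨theta13LiveOfRecord F N, Zr⟩, Zh, Phih⟩ : Stage13HParams F N)) u E₁
      (E0_nonneg_theta13LiveOfFamily F N eps0OfRecord₁₃ (zeta316OfRecord F N (numerics7OfFamily eps0OfRecord₁₃) 1 1) (RzOfRecord F N) (ZtOfRecord F N)) habs hloc hlink) hres
    (operandRowsAlongChain_firstStepSupplier (⟨⟨theta13LiveOfRecord F N, Zr⟩, Zh, Phih⟩ : Stage13HParams F N) p u E₁ hrows)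

end Record

end Summit.QuantumFields.YangMills.Theorems.BalabanUVNodesN11SupplyChainFirstStepSupplier

end
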